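/-
Copyright: pub-qadeq cell (QuantumAdvantage), unit pub-qadeq-deq-2. Released under the project licence.
-/
import Mathlib

/-!
HONEST FRAMING: instance-level adjudication of specific advantage claims; no claim about BQP vs BPP
or the summit.

# No popular keys under the spectral precondition of a sublinear attention algorithm

Staged for `Summits/QuantumAdvantage/Dequantization/SoftmaxHeavyKeys.lean` (deq-2 note DEQ-A155 §2.4 (S1)
and §8, on arXiv:2602.00874, Song–Xue–Zhang–Zhang, *Sublinear Time Quantum Algorithm for Attention
Approximation*, ICLR 2026, Theorem 9.2).

Setting.  `A : Matrix m n ℝ` is the (entrywise positive, but we do not need that) unnormalised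
attention matrix `A = exp(QKᵀ)`, `D i = ∑ j, A i j` its row sums and `Dmin` a lower bound for them, so
that `‖D⁻¹‖ = 1 / min D ≤ 1 / Dmin`.  Theorem 9.2 of the paper requires `‖D⁻¹‖ < 1 / (ε ‖A‖ + λ √n)`,
which implies `ε * ‖A‖ < Dmin` for the spectral norm `‖A‖` (hypothesis `hpre` below, with `Dmin = min D`).

Results (all elementary; [OURS] = this cell's bookkeeping, not a published theorem):
* `card_heavyRows_mul_le`      — `#{i : η·D i ≤ A i j} · (η·Dmin)² ≤ ∑ i, (A i j)²` (counting);
* `card_heavyRows_lt`          — if `ε² · ∑ i (A i j)² < Dmin²` then `#{i : η·D i ≤ A i j} < 1/(ε η)²`;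
* `sum_sq_col_le_l2OpNorm_sq`  — every column of `A` has Euclidean norm at most the spectral norm;
* `card_heavyRows_lt_of_l2OpNorm` — under the paper's precondition `ε ‖A‖ < Dmin`, fewer than
  `1/(ε η)²` rows can give softmax weight `≥ η` to any single key `j` — independently of the number
  of rows.  (So inputs on which many queries attend sharply to one key are excluded by the
  precondition; e.g. `ε = 0.17`, `η = 1/2` allows at most `138` such rows.)
-/

namespace Summit.QuantumAdvantage.Dequantization.SoftmaxHeavyKeys

open Finset

variable {m n : Type*} [Fintype m] [Fintype n]

/-- The rows `i` whose softmax weight on key `j`, namely `A i j / ∑ j', A i j'`, is at least `η`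
(written multiplicatively, so that no division occurs). [OURS] -/
noncomputable def heavyRows (A : Matrix m n ℝ) (η : ℝ) (j : n) : Finset m :=
  univ.filter (fun i => η * ∑ j', A i j' ≤ A i j)

omit [Fintype m] in
/-- Membership in `heavyRows`, unfolded. [OURS] -/
theorem mem_heavyRows {A : Matrix m n ℝ} {η : ℝ} {j : n} {i : m} [Fintype m] :
    i ∈ heavyRows A η j ↔ η * ∑ j', A i j' ≤ A i j := by
  simp [heavyRows]

/-- Counting inequality: each heavy row contributes at least `(η·Dmin)²` to the squared column norm.
[OURS] -/
theorem card_heavyRows_mul_le (A : Matrix m n ℝ) {η Dmin : ℝ} (hη : 0 ≤ η) (hDmin : 0 ≤ Dmin)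
    (hD : ∀ i, Dmin ≤ ∑ j', A i j') (j : n) :
    ((heavyRows A η j).card : ℝ) * (η * Dmin) ^ 2 ≤ ∑ i, (A i j) ^ 2 := by
  classical
  calc ((heavyRows A η j).card : ℝ) * (η * Dmin) ^ 2
      = ∑ _i ∈ heavyRows A η j, (η * Dmin) ^ 2 := by
        simp [Finset.sum_const, nsmul_eq_mul]
    _ ≤ ∑ i ∈ heavyRows A η j, (A i j) ^ 2 := by
        apply Finset.sum_le_sum
        intro i hi
        have hi' : η * ∑ j', A i j' ≤ A i j := mem_heavyRows.mp hi
        have h1 : η * Dmin ≤ η * ∑ j', A i j' := mul_le_mul_of_nonneg_left (hD i) hη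
        have h0 : 0 ≤ η * Dmin := mul_nonneg hη hDmin
        exact pow_le_pow_left₀ h0 (h1.trans hi') 2
    _ ≤ ∑ i, (A i j) ^ 2 := by
        apply Finset.sum_le_sum_of_subset_of_nonneg (Finset.subset_univ _)
        intro i _ _
        positivity

/-- Norm-free form: if `ε² ∑ i (A i j)² < Dmin²` then fewer than `1/(ε η)²` rows give weight `≥ η`
to key `j`. [OURS] -/
theorem card_heavyRows_lt (A : Matrix m n ℝ) {ε η Dmin : ℝ} (hε : 0 < ε) (hη : 0 < η)
    (hDmin : 0 < Dmin) (hD : ∀ i, Dmin ≤ ∑ j', A i j') (j : n)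
    (hcol : ε ^ 2 * ∑ i, (A i j) ^ 2 < Dmin ^ 2) :
    ((heavyRows A η j).card : ℝ) < 1 / (ε * η) ^ 2 := by
  have h := card_heavyRows_mul_le A hη.le hDmin.le hD j
  have hεη : 0 < (ε * η) ^ 2 := by positivity
  rw [lt_div_iff₀ hεη]
  have key : ((heavyRows A η j).card : ℝ) * (ε * η) ^ 2 * Dmin ^ 2 < 1 * Dmin ^ 2 := by
    calc ((heavyRows A η j).card : ℝ) * (ε * η) ^ 2 * Dmin ^ 2
        = ε ^ 2 * (((heavyRows A η j).card : ℝ) * (η * Dmin) ^ 2) := by ring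
      _ ≤ ε ^ 2 * ∑ i, (A i j) ^ 2 := by gcongr
      _ < Dmin ^ 2 := hcol
      _ = 1 * Dmin ^ 2 := by ring
  exact lt_of_mul_lt_mul_right key (by positivity)

section L2

open scoped Matrix.Norms.L2Operator

/-- Every column of a real matrix has Euclidean norm at most the spectral (`ℓ² → ℓ²` operator) norm:
`∑ i, (A i j)² ≤ ‖A‖²`. [folklore] -/
theorem sum_sq_col_le_l2OpNorm_sq [DecidableEq n] (A : Matrix m n ℝ) (j : n) :
    ∑ i, (A i j) ^ 2 ≤ ‖A‖ ^ 2 := by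
  set x : EuclideanSpace ℝ n := EuclideanSpace.single j (1 : ℝ) with hx
  have hxn : ‖x‖ = 1 := by simp [hx]
  have h := Matrix.l2_opNorm_mulVec A x
  rw [hxn, mul_one] at h
  have hcol : A.mulVec x.ofLp = fun i => A i j := by
    have : x.ofLp = Pi.single j (1 : ℝ) := by simp [hx]
    rw [this, Matrix.mulVec_single_one]
    rfl
  have hn : ‖(EuclideanSpace.equiv m ℝ).symm (A.mulVec x.ofLp)‖ ^ 2 = ∑ i, (A i j) ^ 2 := by
    rw [EuclideanSpace.real_norm_sq_eq, hcol]
    rfl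
  rw [← hn]
  exact pow_le_pow_left₀ (norm_nonneg _) h 2

/-- **No popular keys.**  Under the spectral precondition `ε ‖A‖ < Dmin ≤ D i` of
arXiv:2602.00874 Thm 9.2 (there `‖D⁻¹‖ < 1/(ε‖A‖ + λ√n)` with `‖D⁻¹‖ = 1/min D`), fewer than `1/(ε η)²`
rows can give softmax weight at least `η` to any fixed key `j`. [OURS] -/
theorem card_heavyRows_lt_of_l2OpNorm [DecidableEq n] (A : Matrix m n ℝ) {ε η Dmin : ℝ}
    (hε : 0 < ε) (hη : 0 < η) (hDmin : 0 < Dmin) (hD : ∀ i, Dmin ≤ ∑ j', A i j')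
    (hpre : ε * ‖A‖ < Dmin) (j : n) :
    ((heavyRows A η j).card : ℝ) < 1 / (ε * η) ^ 2 := by
  apply card_heavyRows_lt A hε hη hDmin hD j
  have h1 : ε ^ 2 * ∑ i, (A i j) ^ 2 ≤ (ε * ‖A‖) ^ 2 := by
    rw [mul_pow]
    gcongr
    exact sum_sq_col_le_l2OpNorm_sq A j
  have h2 : (ε * ‖A‖) ^ 2 < Dmin ^ 2 := by
    have h0 : 0 ≤ ε * ‖A‖ := by positivity
    exact pow_lt_pow_left₀ hpre h0 two_ne_zero
  exact h1.trans_lt h2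

end L2

/-- Toy sanity instance (decidable arithmetic only): with `ε = 17/100` (the paper's measured `ε_max ≈ 0.17`
for OLMo-1B/7B, Table 3: 0.1708 / 0.1685) and `η = 1/2`, the bound `1/(εη)²` equals `40000/289 < 139`. -/
example : (1 : ℚ) / ((17 / 100) * (1 / 2)) ^ 2 < 139 := by norm_num

end Summit.QuantumAdvantage.Dequantization.SoftmaxHeavyKeys
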